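import Summits.Ventures.Crystal3D.Theorems.StickyWulffConstantGenericWallFloorSaturationStructure
import Summits.Ventures.Crystal3D.Theorems.StickyWulffConstantGenericWallFloorSlotDozensCubic
import Summits.Ventures.Crystal3D.Theorems.StickyWulffConstantGenericWallFloorCredits
import Mathlib.Analysis.Normed.Module.FiniteDimension
import HarnessLib

/-!
# The pocket lemma: a complete close-packed dozen excludes every other ball from the open `√2`-ball,
# and the FOREIGN-BALL DICHOTOMY «a saturated ball with a non-contact ball within `√3` has an unsaturated
# ball within distance `2`, or that ball is DOCKED» (crux `GenericWallFloor`, stmt-Ventures-19480, line `WallLedgerG`)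

HONEST FRAMING. Venture `Summits/Ventures/Crystal3D` (cell `crystal3d-full`), helper `--supports` the crux
`GenericWallFloor` of `route-Ventures-StickyWulffConstant`, REGISTERED line `WallLedgerG`, open stub
`stub_twoSlabAdhesion`.  Rung credit only; F-C1 not moved; NOT the crux.  CENSUS-FREE: §1–§3 use nothing but the
two kissing patterns; §4 takes the named facts `KissingGap δ`, `KissingClassification δ` (`δ ≥ 5/2`, the tree's
computational grade) as hypotheses, exactly like `…SaturationStructure`.

WHY (cf-p1 DECISION (xlii) §86(131)/§87.1, item (G-c) «structural off-site lemma», owner 19480-p1 g10).  The sentence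
of record «an off-site foreign ball within `√(8/3)` of an end ball is unsaturated / addable-adjacent and pays» is FALSE
as a local statement (memo STRUCTURAL-GLUE-g10 on the item: an end ball hovering in a SQUARE POCKET of a saturated
close-packed foreign ball `x`, touching two adjacent shell balls, lies at distance `1.5704…1.6330 ≤ √(8/3)` from `x` with
the ten other shell balls `≥ 5/4` away — nothing local makes `x` pay).  What IS true, and is landed here:
* §1 **covering radius `45°` of both kissing patterns**: every `d` has a pattern vector `p` with `‖d‖ ≤ √2 ⟪p, d⟫`
  (hcp via the twin-reflection symmetry of the anticuboctahedron, `twinRefl_mem_hcp`); moved by any linear isometry.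
* §2 **POCKET LEMMA** (`sqrt_two_le_dist_of_closePackedDozen`): in a `1`-separated `X` containing a complete close-packed
  dozen `x + B p`, every OTHER ball `z ∈ X` with `dist x z ≥ 1` has `dist x z ≥ √2` (sharp: the octahedral sites) —
  nothing touches `x` off the dozen, nothing sits at distance in `(1, √2)`.
* §3 **near-shell lemma** (`exists_dozen_dist_lt_five_fourths`): every point within `√3` of the centre of a complete
  close-packed dozen is within `5/4` — the GAP radius — of a shell ball (`4 − √6 < 25/16`).
* §4 **mod GAP ∧ CLASSIFICATION**: `two_unsaturated_of_dist_lt_sqrt_two` (a saturated ball with another ball at distance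
  in `(1, √2)` has two unsaturated contact neighbours) and the **FOREIGN-BALL DICHOTOMY**
  `unsaturated_near_or_docked_of_saturated`: `x ∈ X` saturated, `z ∈ X` with `1 < dist x z ≤ √3` ⇒ EITHER some ball
  `y ≠ z` with `dist x y ≤ 2` has at most eleven contacts (a PAYER), OR `z` is DOCKED: `z = s + B′p′` at an exact
  pattern position of a saturated close-packed contact-neighbour `s` of `x` (`x = s + B′p″` too) — the EXACT branch a
  finite enumeration can list.  True form of (G-c): «foreign and NOT docked ⇒ a payer within distance 2 of x».
WHAT THIS IS NOT: no ledger, no attribution rule (a payer may serve several pairs), nothing tying the docking frame `B′`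
to the plates (rigidity/sealing, `…DozenRigidity`/`…SealedStates`); F-C1 not moved.
-/

noncomputable section

namespace Summit.Ventures.Crystal3D.Theorems

open Summit.Ventures.Crystal3D Finset
open Literature.Geometry.DiscreteGeometry (fccKissingPattern hcpKissingPattern fccInt hcpInt intVec intVec_apply
  scaledPattern norm_eq_one_of_mem_fccKissingPattern norm_eq_one_of_mem_hcpKissingPattern IsArrangedIn)
open scoped InnerProductSpace

variable {X : Finset (EuclideanSpace ℝ (Fin 3))}

/-! ### §1 Covering radius `45°` of the two kissing patterns -/

/-- `√(s² + t² + u²) ≤ s + t` when `0 ≤ u ≤ s, t`. -/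
theorem sqrt_three_sq_le_add {s t u : ℝ} (hs : 0 ≤ s) (ht : 0 ≤ t) (hu : 0 ≤ u) (hus : u ≤ s) (hut : u ≤ t) :
    Real.sqrt (s ^ 2 + t ^ 2 + u ^ 2) ≤ s + t := by
  rw [Real.sqrt_le_left (by positivity)]
  nlinarith [mul_le_mul hus hut hu hs]

/-- Two of the three coordinates always dominate the norm: `‖d‖ ≤ |dᵢ| + |dⱼ|` for the two largest in absolute value. -/
theorem exists_pair_norm_le (d : EuclideanSpace ℝ (Fin 3)) :
    ‖d‖ ≤ |d 0| + |d 1| ∨ ‖d‖ ≤ |d 0| + |d 2| ∨ ‖d‖ ≤ |d 1| + |d 2| := by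
  have hn : ‖d‖ = Real.sqrt (|d 0| ^ 2 + |d 1| ^ 2 + |d 2| ^ 2) := by
    rw [EuclideanSpace.norm_eq, Fin.sum_univ_three]
    simp only [Real.norm_eq_abs]
  obtain ⟨h0, h1, h2⟩ : 0 ≤ |d 0| ∧ 0 ≤ |d 1| ∧ 0 ≤ |d 2| := ⟨abs_nonneg _, abs_nonneg _, abs_nonneg _⟩
  have p01 : |d 2| ≤ |d 0| → |d 2| ≤ |d 1| → ‖d‖ ≤ |d 0| + |d 1| := fun ha hb => by
    rw [hn]; exact sqrt_three_sq_le_add h0 h1 h2 ha hb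
  have p02 : |d 1| ≤ |d 0| → |d 1| ≤ |d 2| → ‖d‖ ≤ |d 0| + |d 2| := fun ha hb => by
    rw [hn, show |d 0| ^ 2 + |d 1| ^ 2 + |d 2| ^ 2 = |d 0| ^ 2 + |d 2| ^ 2 + |d 1| ^ 2 by ring]
    exact sqrt_three_sq_le_add h0 h2 h1 ha hb
  have p12 : |d 0| ≤ |d 1| → |d 0| ≤ |d 2| → ‖d‖ ≤ |d 1| + |d 2| := fun ha hb => by
    rw [hn, show |d 0| ^ 2 + |d 1| ^ 2 + |d 2| ^ 2 = |d 1| ^ 2 + |d 2| ^ 2 + |d 0| ^ 2 by ring]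
    exact sqrt_three_sq_le_add h1 h2 h0 ha hb
  rcases le_total |d 2| |d 0| with h20 | h02
  · rcases le_total |d 2| |d 1| with h21 | h12
    · exact Or.inl (p01 h20 h21)
    · exact Or.inr (Or.inl (p02 (h12.trans h20) h12))
  · rcases le_total |d 0| |d 1| with h01 | h10
    · exact Or.inr (Or.inr (p12 h01 h02))
    · exact Or.inr (Or.inl (p02 h10 (h10.trans h02)))

/-- The sign unit `±1 ∈ ℤ` of a real number (`+1` at `0`) recovers the absolute value: `(±1)·t = |t|`. -/
theorem ite_sign_mul (t : ℝ) : ((if 0 ≤ t then (1 : ℤ) else -1 : ℤ) : ℝ) * t = |t| := by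
  split_ifs with h
  · rw [abs_of_nonneg h]; simp
  · rw [abs_of_neg (not_le.1 h)]; simp

/-- Inner product of an fcc-scaled integer vector with `d`: `⟪v/√2, d⟫ = (v₀d₀ + v₁d₁ + v₂d₂)/√2`. -/
theorem inner_fccScaled (v : Fin 3 → ℤ) (d : EuclideanSpace ℝ (Fin 3)) :
    ⟪((Real.sqrt ((2 : ℕ) : ℝ))⁻¹ • intVec v : EuclideanSpace ℝ (Fin 3)), d⟫_ℝ =
      (Real.sqrt 2)⁻¹ * ((v 0 : ℝ) * d 0 + (v 1 : ℝ) * d 1 + (v 2 : ℝ) * d 2) := by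
  rw [real_inner_smul_left]
  simp only [PiLp.inner_apply, intVec_apply, RCLike.inner_apply, conj_trivial, Fin.sum_univ_three]
  push_cast; ring

/-- An explicit fcc witness: `v ∈ fccInt` with `‖d‖ ≤ v·d` gives a pattern vector with `‖d‖ ≤ √2 ⟪p, d⟫`. -/
theorem fcc_cover_of_intVec {v : Fin 3 → ℤ} (hv : v ∈ fccInt) (d : EuclideanSpace ℝ (Fin 3))
    (h : ‖d‖ ≤ (v 0 : ℝ) * d 0 + (v 1 : ℝ) * d 1 + (v 2 : ℝ) * d 2) :
    ∃ p ∈ fccKissingPattern, p = (Real.sqrt ((2 : ℕ) : ℝ))⁻¹ • intVec v ∧ ‖d‖ ≤ Real.sqrt 2 * ⟪p, d⟫_ℝ := by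
  refine ⟨_, Finset.mem_image.2 ⟨v, hv, rfl⟩, rfl, ?_⟩
  rw [inner_fccScaled, ← mul_assoc, mul_inv_cancel₀ (by positivity), one_mul]
  exact h

/-- **Upper-half refinement.**  If `d₀ + d₁ + d₂ ≥ 0` the covering vector can be taken in the closed UPPER part of
the cuboctahedron (coordinate sum `≥ 0`: the hexagon or the upper triangle), i.e. inside the anticuboctahedron too. -/
theorem exists_fcc_nonneg_norm_le_sqrt_two_inner (d : EuclideanSpace ℝ (Fin 3)) (hd : 0 ≤ d 0 + d 1 + d 2) :
    ∃ p ∈ fccKissingPattern, 0 ≤ p 0 + p 1 + p 2 ∧ ‖d‖ ≤ Real.sqrt 2 * ⟪p, d⟫_ℝ := by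
  have hs2 : (0 : ℝ) < (Real.sqrt ((2 : ℕ) : ℝ))⁻¹ := by positivity
  have m : ∀ a b : ℝ, ![(if 0 ≤ a then (1 : ℤ) else -1), (if 0 ≤ b then (1 : ℤ) else -1), 0] ∈ fccInt ∧
      ![(if 0 ≤ a then (1 : ℤ) else -1), 0, (if 0 ≤ b then (1 : ℤ) else -1)] ∈ fccInt ∧
      ![0, (if 0 ≤ a then (1 : ℤ) else -1), (if 0 ≤ b then (1 : ℤ) else -1)] ∈ fccInt := by
    intro a b; split_ifs <;> decide
  have msum : ∀ a b : ℝ, (0 ≤ a ∨ 0 ≤ b) →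
      (0 : ℤ) ≤ (if 0 ≤ a then (1 : ℤ) else -1) + (if 0 ≤ b then (1 : ℤ) else -1) := by
    rintro a b (h | h) <;> simp only [if_pos h] <;> split_ifs <;> norm_num
  have hx : ![(-1 : ℤ), 0, 1] ∈ fccInt ∧ ![(-1 : ℤ), 1, 0] ∈ fccInt ∧ ![(1 : ℤ), -1, 0] ∈ fccInt := by decide
  have pack : ∀ v : Fin 3 → ℤ, v ∈ fccInt → (0 : ℤ) ≤ v 0 + v 1 + v 2 →
      ‖d‖ ≤ (v 0 : ℝ) * d 0 + (v 1 : ℝ) * d 1 + (v 2 : ℝ) * d 2 →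
      ∃ p ∈ fccKissingPattern, 0 ≤ p 0 + p 1 + p 2 ∧ ‖d‖ ≤ Real.sqrt 2 * ⟪p, d⟫_ℝ := by
    intro v hv hs h
    obtain ⟨p, hp, rfl, hle⟩ := fcc_cover_of_intVec hv d h
    refine ⟨_, hp, ?_, hle⟩
    rw [sum_coord_scaled]
    exact mul_nonneg hs2.le (Int.cast_nonneg hs)
  rcases exists_pair_norm_le d with h | h | h
  · by_cases hneg : d 0 < 0 ∧ d 1 < 0
    · refine pack _ hx.1 (by simp) ?_
      simp only [Matrix.cons_val_zero, Matrix.cons_val_one, Matrix.cons_val]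
      rw [abs_of_neg hneg.1, abs_of_neg hneg.2] at h
      push_cast; linarith [hneg.1]
    · have hor : 0 ≤ d 0 ∨ 0 ≤ d 1 := by by_contra hc; push Not at hc; exact hneg hc
      refine pack _ (m (d 0) (d 1)).1 ?_ ?_
      · simp only [Matrix.cons_val_zero, Matrix.cons_val_one, Matrix.cons_val, add_zero]; exact msum _ _ hor
      · simp only [Matrix.cons_val_zero, Matrix.cons_val_one, Matrix.cons_val]
        rw [← ite_sign_mul (d 0), ← ite_sign_mul (d 1)] at h; push_cast at h ⊢; linarith
  · by_cases hneg : d 0 < 0 ∧ d 2 < 0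
    · refine pack _ hx.2.1 (by simp) ?_
      simp only [Matrix.cons_val_zero, Matrix.cons_val_one, Matrix.cons_val]
      rw [abs_of_neg hneg.1, abs_of_neg hneg.2] at h
      push_cast; linarith [hneg.1]
    · have hor : 0 ≤ d 0 ∨ 0 ≤ d 2 := by by_contra hc; push Not at hc; exact hneg hc
      refine pack _ (m (d 0) (d 2)).2.1 ?_ ?_
      · simp only [Matrix.cons_val_zero, Matrix.cons_val_one, Matrix.cons_val, add_zero]
        exact msum _ _ hor
      · simp only [Matrix.cons_val_zero, Matrix.cons_val_one, Matrix.cons_val]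
        rw [← ite_sign_mul (d 0), ← ite_sign_mul (d 2)] at h; push_cast at h ⊢; linarith
  · by_cases hneg : d 1 < 0 ∧ d 2 < 0
    · refine pack _ hx.2.2 (by simp) ?_
      simp only [Matrix.cons_val_zero, Matrix.cons_val_one, Matrix.cons_val]
      rw [abs_of_neg hneg.1, abs_of_neg hneg.2] at h
      push_cast; linarith [hneg.1]
    · have hor : 0 ≤ d 1 ∨ 0 ≤ d 2 := by by_contra hc; push Not at hc; exact hneg hc
      refine pack _ (m (d 1) (d 2)).2.2 ?_ ?_
      · simp only [Matrix.cons_val_zero, Matrix.cons_val_one, Matrix.cons_val, zero_add]; exact msum _ _ hor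
      · simp only [Matrix.cons_val_zero, Matrix.cons_val_one, Matrix.cons_val]
        rw [← ite_sign_mul (d 1), ← ite_sign_mul (d 2)] at h; push_cast at h ⊢; linarith

/-- The cuboctahedron is centrally symmetric. -/
theorem neg_mem_fccKissingPattern {p : EuclideanSpace ℝ (Fin 3)} (hp : p ∈ fccKissingPattern) :
    -p ∈ fccKissingPattern := by
  obtain ⟨v, hv, rfl⟩ := Finset.mem_image.1 hp
  have hneg : ∀ w ∈ fccInt, -w ∈ fccInt := by decide
  refine Finset.mem_image.2 ⟨-v, hneg v hv, ?_⟩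
  rw [← smul_neg]; congr 1; ext i; simp [intVec_apply]

/-- **Covering radius `45°` of the cuboctahedron.**  For every `d ∈ ℝ³` some fcc pattern vector `p` (a unit vector
`(±1,±1,0)/√2` up to permutation) has `⟪p, d⟫ ≥ ‖d‖/√2` (lower half-space by central symmetry). -/
theorem exists_fcc_norm_le_sqrt_two_inner (d : EuclideanSpace ℝ (Fin 3)) :
    ∃ p ∈ fccKissingPattern, ‖d‖ ≤ Real.sqrt 2 * ⟪p, d⟫_ℝ := by
  rcases le_or_gt 0 (d 0 + d 1 + d 2) with hd | hd
  · obtain ⟨p, hp, -, hle⟩ := exists_fcc_nonneg_norm_le_sqrt_two_inner d hd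
    exact ⟨p, hp, hle⟩
  · obtain ⟨p, hp, -, hle⟩ := exists_fcc_nonneg_norm_le_sqrt_two_inner (-d)
      (by simp only [PiLp.neg_apply]; linarith)
    exact ⟨-p, neg_mem_fccKissingPattern hp, by rwa [inner_neg_left, ← inner_neg_right, ← norm_neg d]⟩

/-- The twin reflection reverses the coordinate sum: `(Rd)₀ + (Rd)₁ + (Rd)₂ = −(d₀ + d₁ + d₂)`. -/
theorem sum_coord_twinRefl (d : EuclideanSpace ℝ (Fin 3)) :
    (ℝ ∙ (intVec ![1, 1, 1] : EuclideanSpace ℝ (Fin 3)))ᗮ.reflection d 0 +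
      (ℝ ∙ (intVec ![1, 1, 1] : EuclideanSpace ℝ (Fin 3)))ᗮ.reflection d 1 +
      (ℝ ∙ (intVec ![1, 1, 1] : EuclideanSpace ℝ (Fin 3)))ᗮ.reflection d 2 = -(d 0 + d 1 + d 2) := by
  rw [twinRefl_apply_coord, twinRefl_apply_coord, twinRefl_apply_coord]
  ring

/-- **Covering radius `45°` of the anticuboctahedron.**  For every `d ∈ ℝ³` some hcp pattern vector `p` has
`⟪p, d⟫ ≥ ‖d‖/√2`.  Upper half-space: the upper part of the cuboctahedron lies in the anticuboctahedron
(`mem_hcp_of_mem_fcc_of_nonneg`); lower half-space: conjugate by the twin reflection, a symmetry of the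
anticuboctahedron (`twinRefl_mem_hcp`). -/
theorem exists_hcp_norm_le_sqrt_two_inner (d : EuclideanSpace ℝ (Fin 3)) :
    ∃ p ∈ hcpKissingPattern, ‖d‖ ≤ Real.sqrt 2 * ⟪p, d⟫_ℝ := by
  rcases le_or_gt 0 (d 0 + d 1 + d 2) with hd | hd
  · obtain ⟨p, hp, hs, hle⟩ := exists_fcc_nonneg_norm_le_sqrt_two_inner d hd
    exact ⟨p, mem_hcp_of_mem_fcc_of_nonneg hp hs, hle⟩
  · set R := (ℝ ∙ (intVec ![1, 1, 1] : EuclideanSpace ℝ (Fin 3)))ᗮ.reflection with hR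
    have hd' : 0 ≤ R d 0 + R d 1 + R d 2 := by rw [hR, sum_coord_twinRefl]; linarith
    obtain ⟨q, hq, hs, hle⟩ := exists_fcc_nonneg_norm_le_sqrt_two_inner (R d) hd'
    refine ⟨R q, twinRefl_mem_hcp (mem_hcp_of_mem_fcc_of_nonneg hq hs), ?_⟩
    have h1 : ⟪R q, d⟫_ℝ = ⟪q, R d⟫_ℝ := by
      conv_lhs => rw [← Submodule.reflection_reflection (ℝ ∙ (intVec ![1, 1, 1] : EuclideanSpace ℝ (Fin 3)))ᗮ d]
      rw [hR, LinearIsometryEquiv.inner_map_map]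
    rw [h1, ← LinearIsometryEquiv.norm_map R d]
    exact hle

/-- **Either pattern, moved by any linear isometry.**  For `P` the fcc or the hcp kissing pattern and `B` a linear
isometry of `ℝ³`: every `d` has some `p ∈ P` with `‖d‖ ≤ √2 ⟪B p, d⟫`. -/
theorem exists_pattern_norm_le_sqrt_two_inner {P : Finset (EuclideanSpace ℝ (Fin 3))}
    (hP : P = fccKissingPattern ∨ P = hcpKissingPattern)
    (B : EuclideanSpace ℝ (Fin 3) →ₗᵢ[ℝ] EuclideanSpace ℝ (Fin 3)) (d : EuclideanSpace ℝ (Fin 3)) :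
    ∃ p ∈ P, ‖d‖ ≤ Real.sqrt 2 * ⟪B p, d⟫_ℝ := by
  set Be := B.toLinearIsometryEquiv rfl with hBe
  set d' := Be.symm d with hd'
  have hd : B d' = d := by rw [← LinearIsometry.coe_toLinearIsometryEquiv B rfl, hd', LinearIsometryEquiv.apply_symm_apply]
  have key : ∀ p, ⟪B p, d⟫_ℝ = ⟪p, d'⟫_ℝ := fun p => by rw [← hd, LinearIsometry.inner_map_map]
  have hn : ‖d‖ = ‖d'‖ := by rw [← hd, LinearIsometry.norm_map]
  rcases hP with rfl | rfl
  · obtain ⟨p, hp, hle⟩ := exists_fcc_norm_le_sqrt_two_inner d'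
    exact ⟨p, hp, by rw [key, hn]; exact hle⟩
  · obtain ⟨p, hp, hle⟩ := exists_hcp_norm_le_sqrt_two_inner d'
    exact ⟨p, hp, by rw [key, hn]; exact hle⟩

/-! ### §2 The pocket lemma -/

/-- Pattern vectors are unit vectors (either pattern). -/
theorem norm_eq_one_of_mem_pattern {P : Finset (EuclideanSpace ℝ (Fin 3))}
    (hP : P = fccKissingPattern ∨ P = hcpKissingPattern) {p : EuclideanSpace ℝ (Fin 3)} (hp : p ∈ P) : ‖p‖ = 1 := by
  rcases hP with rfl | rfl
  · exact norm_eq_one_of_mem_fccKissingPattern hp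
  · exact norm_eq_one_of_mem_hcpKissingPattern hp

/-- **Distance to the covering shell ball.**  With a complete close-packed dozen `x + B p` and ANY point `z`, the shell
ball `x + B p` chosen by the covering lemma satisfies `dist(z, x + B p)² ≤ r² − √2·r + 1`, `r = dist x z`. -/
theorem exists_dozen_dist_sq_le {P : Finset (EuclideanSpace ℝ (Fin 3))}
    (hP : P = fccKissingPattern ∨ P = hcpKissingPattern)
    (B : EuclideanSpace ℝ (Fin 3) →ₗᵢ[ℝ] EuclideanSpace ℝ (Fin 3)) (x z : EuclideanSpace ℝ (Fin 3)) :
    ∃ p ∈ P, dist z (x + B p) ^ 2 ≤ dist x z ^ 2 - Real.sqrt 2 * dist x z + 1 := by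
  obtain ⟨p, hp, hle⟩ := exists_pattern_norm_le_sqrt_two_inner hP B (z - x)
  refine ⟨p, hp, ?_⟩
  have h1 : ‖B p‖ = 1 := by rw [LinearIsometry.norm_map, norm_eq_one_of_mem_pattern hP hp]
  have hd : dist z (x + B p) = ‖(z - x) - B p‖ := by rw [dist_eq_norm]; congr 1; abel
  have h2 : Real.sqrt 2 * Real.sqrt 2 = 2 := Real.mul_self_sqrt (by norm_num)
  have hle2 : Real.sqrt 2 * ‖z - x‖ ≤ 2 * ⟪B p, z - x⟫_ℝ := by
    have := mul_le_mul_of_nonneg_left hle (Real.sqrt_nonneg 2)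
    rwa [← mul_assoc, h2] at this
  rw [hd, norm_sub_sq_real, h1, dist_comm, dist_eq_norm, real_inner_comm]
  linarith

/-- **POCKET LEMMA.**  In a `1`-separated configuration `X` containing a complete close-packed dozen
`{x + B p : p ∈ P}` (`P` the fcc or hcp kissing pattern, `B` a linear isometry), every ball `z ∈ X` that is not one of
the twelve and has `dist x z ≥ 1` (e.g. `x ∈ X`, `z ≠ x`) satisfies `dist x z ≥ √2`: the twelve unit balls and the
central one leave no room strictly inside the `√2`-sphere (sharp — the six octahedral sites are at distance `√2`).
Census-free; no kissing facts. -/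
theorem sqrt_two_le_dist_of_closePackedDozen (hX : ∀ p ∈ X, ∀ q ∈ X, p ≠ q → 1 ≤ dist p q)
    {P : Finset (EuclideanSpace ℝ (Fin 3))} (hP : P = fccKissingPattern ∨ P = hcpKissingPattern)
    (B : EuclideanSpace ℝ (Fin 3) →ₗᵢ[ℝ] EuclideanSpace ℝ (Fin 3)) {x : EuclideanSpace ℝ (Fin 3)}
    (hocc : ∀ p ∈ P, x + B p ∈ X) {z : EuclideanSpace ℝ (Fin 3)} (hz : z ∈ X) (h1 : 1 ≤ dist x z)
    (hnot : ∀ p ∈ P, z ≠ x + B p) : Real.sqrt 2 ≤ dist x z := by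
  by_contra hlt
  push Not at hlt
  obtain ⟨p, hp, hle⟩ := exists_dozen_dist_sq_le hP B x z
  have hsep := hX z hz (x + B p) (hocc p hp) (hnot p hp)
  have hr : dist x z ^ 2 - Real.sqrt 2 * dist x z < 0 := by nlinarith [hlt, h1]
  nlinarith [hsep, hle, hr, dist_nonneg (x := z) (y := x + B p)]

/-- **Contact form.**  Under the same hypotheses a ball `z ∈ X` at distance `< √2` from `x` (and `≥ 1`) IS one of the
twelve dozen balls: nothing touches `x` off the dozen, nothing sits at distance in `(1, √2)`. -/
theorem mem_dozen_of_dist_lt_sqrt_two (hX : ∀ p ∈ X, ∀ q ∈ X, p ≠ q → 1 ≤ dist p q)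
    {P : Finset (EuclideanSpace ℝ (Fin 3))} (hP : P = fccKissingPattern ∨ P = hcpKissingPattern)
    (B : EuclideanSpace ℝ (Fin 3) →ₗᵢ[ℝ] EuclideanSpace ℝ (Fin 3)) {x : EuclideanSpace ℝ (Fin 3)}
    (hocc : ∀ p ∈ P, x + B p ∈ X) {z : EuclideanSpace ℝ (Fin 3)} (hz : z ∈ X) (h1 : 1 ≤ dist x z)
    (hlt : dist x z < Real.sqrt 2) : ∃ p ∈ P, z = x + B p := by
  by_contra h; push Not at h
  exact absurd (sqrt_two_le_dist_of_closePackedDozen hX hP B hocc hz h1 h) (not_le.2 hlt)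

/-! ### §3 The near-shell lemma -/

/-- `4 − √6 < 25/16`, i.e. `√6 > 39/16`. -/
theorem four_sub_sqrt_six_lt : (4 : ℝ) - Real.sqrt 2 * Real.sqrt 3 < 25 / 16 := by
  have h6 : Real.sqrt 2 * Real.sqrt 3 = Real.sqrt 6 := by rw [← Real.sqrt_mul (by norm_num)]; norm_num
  have h : (39 / 16 : ℝ) < Real.sqrt 6 := by rw [Real.lt_sqrt (by norm_num)]; norm_num
  rw [h6]; linarith

/-- **NEAR-SHELL LEMMA.**  Every point `z` within `√3` of the centre `x` of a complete close-packed dozen `x + B p` is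
within `5/4` of one of the twelve shell balls (the maximum of `r² − √2 r + 1` on `[0, √3]` is `4 − √6 < (5/4)²`).
Census-free. -/
theorem exists_dozen_dist_lt_five_fourths {P : Finset (EuclideanSpace ℝ (Fin 3))}
    (hP : P = fccKissingPattern ∨ P = hcpKissingPattern)
    (B : EuclideanSpace ℝ (Fin 3) →ₗᵢ[ℝ] EuclideanSpace ℝ (Fin 3)) (x z : EuclideanSpace ℝ (Fin 3))
    (h3 : dist x z ≤ Real.sqrt 3) : ∃ p ∈ P, dist z (x + B p) < 5 / 4 := by
  obtain ⟨p, hp, hle⟩ := exists_dozen_dist_sq_le hP B x z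
  refine ⟨p, hp, ?_⟩
  have hr0 : 0 ≤ dist x z := dist_nonneg
  have hs3 : Real.sqrt 3 ^ 2 = 3 := Real.sq_sqrt (by norm_num)
  have hs23 : Real.sqrt 2 ≤ Real.sqrt 3 := Real.sqrt_le_sqrt (by norm_num)
  have key : dist x z ^ 2 - Real.sqrt 2 * dist x z ≤ 3 - Real.sqrt 2 * Real.sqrt 3 := by
    nlinarith [mul_nonneg hr0 (sub_nonneg.2 h3), mul_nonneg (sub_nonneg.2 hs23) (sub_nonneg.2 h3)]
  have hsq : dist z (x + B p) ^ 2 < (5 / 4) ^ 2 := by nlinarith [four_sub_sqrt_six_lt, key, hle]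
  exact (abs_lt_of_sq_lt_sq' hsq (by norm_num)).2

/-! ### §4 Consequences modulo GAP ∧ CLASSIFICATION -/

/-- A close-packed shell in the tree's `IsArrangedIn` currency yields a frame `B` and a pattern `P`. -/
theorem exists_pattern_frame_of_isArrangedIn {x : EuclideanSpace ℝ (Fin 3)}
    (h : IsArrangedIn ((fun q => (2 : ℝ) • (q - x)) '' {q | q ∈ X ∧ dist x q = 1}) fccKissingPattern ∨
      IsArrangedIn ((fun q => (2 : ℝ) • (q - x)) '' {q | q ∈ X ∧ dist x q = 1}) hcpKissingPattern) :
    ∃ (P : Finset (EuclideanSpace ℝ (Fin 3))) (B : EuclideanSpace ℝ (Fin 3) →ₗᵢ[ℝ] EuclideanSpace ℝ (Fin 3)),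
      (P = fccKissingPattern ∨ P = hcpKissingPattern) ∧
      (∀ p ∈ P, x + B p ∈ X ∧ dist x (x + B p) = 1) ∧
      ∀ q ∈ X, dist x q = 1 → ∃ p ∈ P, q = x + B p := by
  rcases h with h | h
  · obtain ⟨B, h1, h2⟩ := neighbours_eq_of_isArrangedIn h
    exact ⟨_, B, Or.inl rfl, h1, h2⟩
  · obtain ⟨B, h1, h2⟩ := neighbours_eq_of_isArrangedIn h
    exact ⟨_, B, Or.inr rfl, h1, h2⟩

/-- **A near non-contact ball breaks the close-packed shell.**  Under GAP(`δ`) ∧ CLASSIFICATION(`δ`): a ball `x` with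
twelve contacts and another ball `z ∈ X` at distance in `(1, √2)` has two distinct contact neighbours with fewer than
twelve contacts each (pocket lemma + residue rule). -/
theorem two_unsaturated_of_dist_lt_sqrt_two {δ : ℝ} (hg : KissingGap δ) (hc : KissingClassification δ)
    (hX : ∀ p ∈ X, ∀ q ∈ X, p ≠ q → 1 ≤ dist p q) {x : EuclideanSpace ℝ (Fin 3)}
    (h12 : (X.filter fun q => dist x q = 1).card = 12) {z : EuclideanSpace ℝ (Fin 3)} (hz : z ∈ X)
    (h1 : 1 < dist x z) (h2 : dist x z < Real.sqrt 2) :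
    ∃ y ∈ X, ∃ y' ∈ X, y ≠ y' ∧ dist x y = 1 ∧ dist x y' = 1 ∧
      (X.filter fun q => dist y q = 1).card ≠ 12 ∧ (X.filter fun q => dist y' q = 1).card ≠ 12 := by
  refine two_unsaturated_of_not_closePacked hg hc hX h12 fun harr => ?_
  obtain ⟨P, B, hP, hB, -⟩ := exists_pattern_frame_of_isArrangedIn harr
  obtain ⟨p, hp, rfl⟩ := mem_dozen_of_dist_lt_sqrt_two hX hP B (fun p hp => (hB p hp).1) hz h1.le h2
  exact absurd (hB p hp).2 (ne_of_gt h1)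

/-- **THE FOREIGN-BALL DICHOTOMY** (true form of item (G-c)).  Under GAP(`δ`) ∧ CLASSIFICATION(`δ`), `δ ≥ 5/2`:
let `x ∈ X` have twelve contacts and let `z ∈ X` be a NON-contact ball within `√3` (`1 < dist x z ≤ √3`).  Then
EITHER (payer) some ball `y ≠ z` with `dist x y ≤ 2` has at most eleven contacts, OR (docked) there is a contact
neighbour `s` of `x` with twelve contacts and a CLOSE-PACKED shell `{s + B p : p ∈ P}` (`P` the fcc or hcp pattern)
containing both `z` and `x` — `z` touches `s` and sits at an exact pattern position of `s`'s frame.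
Route: shell of `x` not close-packed ⇒ residue rule; close-packed ⇒ near-shell lemma gives a shell ball `s` within
`5/4` of `z` ⇒ GAP at `s` (if saturated) forces `dist s z = 1` ⇒ all-but-one classification at `s`. -/
theorem unsaturated_near_or_docked_of_saturated {δ : ℝ} (hg : KissingGap δ) (hc : KissingClassification δ)
    (hδ : 5 / 2 ≤ δ) (hX : ∀ p ∈ X, ∀ q ∈ X, p ≠ q → 1 ≤ dist p q)
    {x : EuclideanSpace ℝ (Fin 3)} (hx : x ∈ X) (h12 : (X.filter fun q => dist x q = 1).card = 12)
    {z : EuclideanSpace ℝ (Fin 3)} (hz : z ∈ X) (h1 : 1 < dist x z) (h3 : dist x z ≤ Real.sqrt 3) :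
    (∃ y ∈ X, y ≠ z ∧ dist x y ≤ 2 ∧ (X.filter fun q => dist y q = 1).card ≤ 11) ∨
    ∃ s ∈ X, ∃ (P : Finset (EuclideanSpace ℝ (Fin 3))) (B : EuclideanSpace ℝ (Fin 3) →ₗᵢ[ℝ] EuclideanSpace ℝ (Fin 3)),
      (P = fccKissingPattern ∨ P = hcpKissingPattern) ∧ dist x s = 1 ∧ dist s z = 1 ∧
      (X.filter fun q => dist s q = 1).card = 12 ∧ (∀ p ∈ P, s + B p ∈ X) ∧
      (∃ p ∈ P, z = s + B p) ∧ ∃ p ∈ P, x = s + B p := by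
  classical
  by_cases harr : IsArrangedIn ((fun q => (2 : ℝ) • (q - x)) '' {q | q ∈ X ∧ dist x q = 1}) fccKissingPattern ∨
      IsArrangedIn ((fun q => (2 : ℝ) • (q - x)) '' {q | q ∈ X ∧ dist x q = 1}) hcpKissingPattern
  · -- close-packed shell of `x`: near-shell lemma, then GAP and all-but-one at the shell ball
    obtain ⟨P, B, hP, hB, -⟩ := exists_pattern_frame_of_isArrangedIn harr
    obtain ⟨p, hp, hnear⟩ := exists_dozen_dist_lt_five_fourths hP B x z h3
    set s := x + B p with hs
    have hsX : s ∈ X := (hB p hp).1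
    have hxs : dist x s = 1 := (hB p hp).2
    have hsz : s ≠ z := fun h => (ne_of_gt h1) (by rw [← h, hxs])
    have hle12 := card_filter_dist_eq_one_le_twelve X hX s
    by_cases hs12 : (X.filter fun q => dist s q = 1).card = 12
    · have hd1 : dist s z = 1 := by
        rcases eq_or_dist_eq_one_or_le_dist_of_saturated hg hX hsX hs12 hz with h | h | h
        · exact absurd h.symm hsz
        · exact h
        · exfalso; rw [dist_comm] at hnear; linarith
      by_cases hnb : ∀ y ∈ X, dist s y = 1 → y ≠ z → (X.filter fun q => dist y q = 1).card = 12
      · right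
        obtain ⟨P', B', hP', hocc, hall⟩ := exists_frame_of_allButOne hg hc hX hs12 z hnb
        refine ⟨s, hsX, P', B', hP', hxs, hd1, hs12, fun q hq => (hocc q hq).1, hall z hz hd1,
          hall x hx (by rw [dist_comm, hxs])⟩
      · left
        push Not at hnb
        obtain ⟨y, hy, hsy, hyz, hy12⟩ := hnb
        have hyle := card_filter_dist_eq_one_le_twelve X hX y
        refine ⟨y, hy, hyz, ?_, by omega⟩
        calc dist x y ≤ dist x s + dist s y := dist_triangle _ _ _
          _ = 2 := by rw [hxs, hsy]; norm_num
    · left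
      exact ⟨s, hsX, hsz, by rw [hxs]; norm_num, by omega⟩
  · -- shell of `x` not close-packed: residue rule
    left
    obtain ⟨y, hy, -, -, -, hxy, -, hy12, -⟩ := two_unsaturated_of_not_closePacked hg hc hX h12 harr
    have hyle := card_filter_dist_eq_one_le_twelve X hX y
    exact ⟨y, hy, fun h => (ne_of_gt h1) (by rw [← h, hxy]), by rw [hxy]; norm_num, by omega⟩

/-- **Corollary: an UNDOCKED foreign ball near a saturated ball locates a payer.**  Same hypotheses; if `z` touches NO
saturated contact-neighbour of `x` (in particular if `z` touches no contact-neighbour of `x` at all, or if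
`√2`-exclusion / `dist x z < √2` already rules contact out), then some `y ≠ z` within distance `2` of `x` has at most
eleven contacts. -/
theorem exists_unsaturated_near_of_undocked {δ : ℝ} (hg : KissingGap δ) (hc : KissingClassification δ)
    (hδ : 5 / 2 ≤ δ) (hX : ∀ p ∈ X, ∀ q ∈ X, p ≠ q → 1 ≤ dist p q)
    {x : EuclideanSpace ℝ (Fin 3)} (hx : x ∈ X) (h12 : (X.filter fun q => dist x q = 1).card = 12)
    {z : EuclideanSpace ℝ (Fin 3)} (hz : z ∈ X) (h1 : 1 < dist x z) (h3 : dist x z ≤ Real.sqrt 3)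
    (hund : ∀ s ∈ X, dist x s = 1 → dist s z = 1 → (X.filter fun q => dist s q = 1).card ≠ 12) :
    ∃ y ∈ X, y ≠ z ∧ dist x y ≤ 2 ∧ (X.filter fun q => dist y q = 1).card ≤ 11 := by
  rcases unsaturated_near_or_docked_of_saturated hg hc hδ hX hx h12 hz h1 h3 with h | h
  · exact h
  · obtain ⟨s, hsX, P, B, -, hxs, hsz, hs12, -⟩ := h
    exact absurd hs12 (hund s hsX hxs hsz)

end Summit.Ventures.Crystal3D.Theorems

end
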